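import Literature.AlgebraicGeometry.Modules.SerreTwistOneGeneratingSections
import Literature.AlgebraicGeometry.Modules.RankOneCocycleIso
import Literature.AlgebraicGeometry.Modules.CokernelSupport
import Literature.AlgebraicGeometry.Motives.GeneratingSectionsToProjRatios
import Literature.AlgebraicGeometry.Motives.GeneratingSectionsOfLineBundle
import HarnessLib

/-!
# The rank-one module whose frame sections define `ι_E : X → 𝐏ʳ` IS `ι_E^*𝒪(1)`
# (Hartshorne II Thm. 7.1 (a) in the Serre-twist module currency)

Layer `Literature/AlgebraicGeometry/Modules`, namespace `Literature.AlgebraicGeometry.Modules.SerreTwist`.  THEOREMS ONLY (no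
definition, no instance, no notation, no named fact, no `sorry`).  Cell `hodgecm-mathlib` (D-0151), F-DAG F-6 (H-rep) generic
`Modules/` brick (V) (B-p18 (g19) cut 2026-08-30, B-plan1 (g17) second hand; census
`B-provers/B-p18/g19/CENSUS-F6-HRep-SiegelFramedCovariantOfHilb.B-p18g19.md`).  Count-neutral Mathlib-side capital: HC_CM is proved only
modulo the 7 printed citations until rung 0 closes — nothing here bears on a summit statement.

THE CONVERSE OF ★ (L1) `Modules/SerreTwistOneGeneratingSections`.  Let `E` be an `𝒪_X`-module with a rank-one frame system `F` (local
generators `b_x` on `U_x`), `s₀, …, s_r ∈ Γ(X, E)` global sections whose non-vanishing loci cover `X`, `D` the generating-sections datum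
of their coefficients (★ `GeneratingSections.ofCocycleSections F.U (CocycleSections.ofFrameSystem F h1 s)`: opens `X_{s_i}`, ratios
`s_j/s_i`) and `φ := D.toProj q : X → 𝐏ʳ_A` the morphism they define ([Hartshorne1977] II Thm. 7.1 (b)).  Then
**`E ≅ 𝒪_X(1) := SerreTwist.twistMod φ 𝒪_X 1`** ([Hartshorne1977] II Thm. 7.1 (a): "`φ^*𝒪(1) ≅ 𝓛` under which `s_i ↔ φ^*x_i`"),
proved WITHOUT re-gluing, through the tree's classification of line bundles by cocycles ([Hartshorne1977] III Ex. 4.5, ★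
`Modules/RankOneCocycleIso.nonempty_iso_of_coboundary`):

* §1 `nonempty_iso_twistMod_one_of_coeffAt` — the CRITERION for an arbitrary `φ : X → 𝐏ʳ_A`: if `X_{s_i} ∩ U_x = φ⁻¹D₊(x_i) ∩ U_x`
  (as the non-vanishing locus of the coefficient of `s_i` in `b_x`) and `φ^*(x_i/x_a) · (s_a)_x = (s_i)_x` on `U_x ∩ φ⁻¹D₊(x_a)`, then
  `E ≅ twistMod φ 𝒪_X 1`.  Proof: the chart frame system of `𝒪_X(-1) = serreTwist φ 1` on the charts `X_{j(x)} ∋ x` (★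
  `SerreTwist.overIsoUnit`, transition functions `x_{j x}/x_{j y}`: ★ `transitionDet_chartFrame`) has DUAL frame system (★
  `FrameSystem.dual`, ★ `dual_cocycle_g`) with cocycle `x_{j y}/x_{j x}`; the coefficients `λ_x := (s_{j x})_x|_{U_x ∩ X_{j x}}` (units
  there) form a coboundary `g_{xy} λ_y = λ_x · x_{j y}/x_{j x}` (★ `map_coeffAt_eq`: `(s_i)_x = (s_i)_y g_{xy}`), so ★
  `nonempty_iso_of_coboundary` gives `E ≅ (serreTwist φ 1)^∨`, and ★ `sheafHomTwistIso φ 𝒪 1 : (serreTwist φ 1)^∨ ≅ twistMod φ 𝒪 1`.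
* §2 the hypotheses of §1 for `φ = D.toProj q`: `Zop_toProj_singleton_eq_U` (`φ⁻¹D₊(x_i) = X_{s_i}`, ★ `toProj_preimage_basicOpen`),
  `isUnit_secRes_coeffAt`, and `secRes_chartFun_toProj_mul_coeffAt` (`φ^*(x_i/x_a) = s_i/s_a`: ★ `homRatio_toProj`, (L1)
  `chartFun_eq_map_homRatio`, ★ `ofCocycleSections_ratio_res_mul`).
* §3 HEADS **`nonempty_iso_twistMod_one_toProj_ofFrameSystem`** (Proj form) and
  **`nonempty_iso_twistMod_one_homEquiv_pointOfSections_ofFrameSystem`** (the `𝐏(J; S)`-form of ★ `Morphisms/ProjectiveSpaceOverBasePoints`,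
  the letter ★ `PolarizedAbelianSchemeWithLevel.IsFrameRigidification` ends in; ★ `homEquiv_pointOfSections`).

## References
* [Hartshorne1977] R. Hartshorne, *Algebraic Geometry* (1977), II Thm. 7.1 (a), (b) (p. 150); II Prop. 5.12 (p. 117); III Ex. 4.5.
* [MumfordFogartyKirwan1994] D. Mumford, J. Fogarty, F. Kirwan, *Geometric Invariant Theory*, 3rd ed. (1994), Ch. 7 §2 Def. 7.5
  (p. 130) (linear rigidifications read through the embedding they define).
-/

noncomputable section

-- `TopCat.Presheaf`/`Scheme.Modules` are not reducible (as in Mathlib's `AlgebraicGeometry/Modules/Sheaf.lean`).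
set_option backward.isDefEq.respectTransparency false

universe u

open CategoryTheory AlgebraicGeometry TopologicalSpace Opposite
open Literature.AlgebraicGeometry.Morphisms Literature.AlgebraicGeometry.Morphisms.ProjCech
open Literature.AlgebraicGeometry.Motives Literature.AlgebraicGeometry.Motives.GeneratingSections

namespace Literature.AlgebraicGeometry.Modules

namespace SerreTwist

variable {A : Type u} [CommRing A] {r : ℕ} {X : Scheme.{u}} {E : X.Modules}
  (F : FrameSystem E) (h1 : ∀ x, F.rank x = 1) (s : Fin (r + 1) → Γ(E, ⊤))

/-! ## §1 The criterion: coefficients with the right loci and ratios give `E ≅ 𝒪_X(1)` -/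

/-- **Criterion for `E ≅ φ^*𝒪(1)` in the Serre-twist model.**  Let `E` carry a rank-one frame system `F` and global sections `s_i`
(`i : Fin (r + 1)`) with coefficients `(s_i)_x = coeffAt F h1 s i x ∈ Γ(X, U_x)`, and let `φ : X → 𝐏ʳ_A`.  If (i) the non-vanishing
locus of `(s_i)_x` is `φ⁻¹D₊(x_i) ∩ U_x`, (ii) at every point some `s_i` has a unit coefficient, and (iii)
`φ^*(x_i/x_a)|_V · (s_a)_y|_V = (s_i)_y|_V` for `V ⊆ U_y ∩ φ⁻¹D₊(x_a)`, then `E ≅ 𝒪_X(1) = twistMod φ 𝒪_X 1`: the coefficients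
`λ_x = (s_{j x})_x` are a coboundary between the cocycle of `F` and the DUAL of the chart cocycle `x_{j x}/x_{j y}` of `𝒪_X(-1)`
(★ `transitionDet_chartFrame`, ★ `FrameSystem.dual_cocycle_g`, ★ `map_coeffAt_eq`), whence `E ≅ 𝒪_X(-1)^∨` (★
`nonempty_iso_of_coboundary`, [Hartshorne1977] III Ex. 4.5) `≅ 𝒪_X(1)` (★ `sheafHomTwistIso`).
[cite: Hartshorne1977, II Thm. 7.1 (a) (p. 150)] [cite: Hartshorne1977, III Ex. 4.5] -/
theorem nonempty_iso_twistMod_one_of_coeffAt (φ : X ⟶ PP A r)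
    (hZ : ∀ (i : Fin (r + 1)) (x : X), Zop φ {i} ⊓ F.U x = X.basicOpen (coeffAt F h1 s i x))
    (hgen : ∀ p : X, ∃ i, p ∈ X.basicOpen (coeffAt F h1 s i p))
    (hrat : ∀ (i a : Fin (r + 1)) (y : X) (V : X.Opens) (hy : V ≤ F.U y) (ha : V ≤ Zop φ {a}),
      secRes X ha (chartFun φ i a) * secRes X hy (coeffAt F h1 s a y) = secRes X hy (coeffAt F h1 s i y)) :
    Nonempty (E ≅ twistMod φ (unitModule X) 1) := by
  classical
  -- a chart choice `x ↦ j x` with `(s_{j x})_x(x) ≠ 0`, hence `x ∈ φ⁻¹D₊(x_{j x})`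
  choose j hj using hgen
  have hjZ : ∀ x, x ∈ Zop φ {j x} := fun x => by
    have hx : x ∈ Zop φ {j x} ⊓ F.U x := by rw [hZ]; exact hj x
    exact hx.1
  -- the chart frame system of `𝒪_X(-1)` on the `X_{j x}` and its transition functions `x_{j x}/x_{j y}`
  let FS : FrameSystem (serreTwist φ 1) :=
    { U := fun x => Zop φ {j x}
      mem := hjZ
      I := fun _ => PUnit.{u + 1}
      rank := fun _ => 1
      enum := fun _ => _root_.Equiv.ofUnique PUnit (Fin 1)
      frame := fun x => freePUnitIso (Zop φ {j x}) ≪≫ (overIsoUnit φ 1 (j x)).symm }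
  have hFSg : ∀ (x y : X) (V : X.Opens) (hx : V ≤ Zop φ {j x}) (hy : V ≤ Zop φ {j y}),
      FS.cocycle.g x y V hx hy = secRes X hy (chartFun φ (j x) (j y)) := fun x y V hx hy => by
    have h := transitionDet_chartFrame φ 1 (j x) (j y) hx hy
    rw [pow_one] at h
    exact h
  -- the dual frame system (of `𝒪_X(-1)^∨`) has the inverse cocycle `x_{j y}/x_{j x}`
  have hdg : ∀ (x y : X) (V : X.Opens) (hx : V ≤ Zop φ {j x}) (hy : V ≤ Zop φ {j y}),
      FS.dual.cocycle.g x y V hx hy = secRes X hx (chartFun φ (j y) (j x)) := fun x y V hx hy => by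
    rw [FrameSystem.dual_cocycle_g, hFSg]
  -- the coefficients `λ_x = (s_{j x})_x` are units on `W_x = φ⁻¹D₊(x_{j x}) ∩ U_x = X_{(s_{j x})_x}`
  have hunit : ∀ (x : X) (V : X.Opens) (hV : V ≤ Zop φ {j x} ⊓ F.U x),
      IsUnit (secRes X (hV.trans inf_le_right) (coeffAt F h1 s (j x) x)) := fun x V hV => by
    have hB : V ≤ X.basicOpen (coeffAt F h1 s (j x) x) := by rw [← hZ]; exact hV
    exact isUnit_map_of_le_basicOpen _ hB
  -- the coboundary `g_{xy} λ_y = λ_x · (x_{j y}/x_{j x})`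
  let b : UnitCocycle.Coboundary FS.dual.cocycle F.cocycle :=
    { W := fun x => Zop φ {j x} ⊓ F.U x
      mem := fun x => ⟨hjZ x, F.mem x⟩
      le := fun _ => inf_le_left
      le' := fun _ => inf_le_right
      lam := fun x V hV => secRes X (hV.trans inf_le_right) (coeffAt F h1 s (j x) x)
      inv := fun x V hV => Ring.inverse (secRes X (hV.trans inf_le_right) (coeffAt F h1 s (j x) x))
      map_lam := fun x _ _ hV i => by rw [secRes_secRes]
      lam_mul_inv := fun x V hV => Ring.mul_inverse_cancel _ (hunit x V hV)
      rel := fun x y V hx hy => by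
        show F.cocycle.g x y V (hx.trans inf_le_right) (hy.trans inf_le_right) *
            secRes X (hy.trans inf_le_right) (coeffAt F h1 s (j y) y) =
          secRes X (hx.trans inf_le_right) (coeffAt F h1 s (j x) x) *
            FS.dual.cocycle.g x y V (hx.trans inf_le_left) (hy.trans inf_le_left)
        have e1 : secRes X (hx.trans inf_le_right) (coeffAt F h1 s (j x) x) =
            secRes X (hy.trans inf_le_right) (coeffAt F h1 s (j x) y) *
              F.cocycle.g x y V (hx.trans inf_le_right) (hy.trans inf_le_right) :=
          map_coeffAt_eq F h1 s (j x) x y (hx.trans inf_le_right) (hy.trans inf_le_right)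
        rw [hdg, e1, ← hrat (j y) (j x) y V (hy.trans inf_le_right) (hx.trans inf_le_left)]
        ring }
  obtain ⟨e⟩ := nonempty_iso_of_coboundary F FS.dual h1 (fun _ => rfl) b.symm
  exact ⟨e ≪≫ sheafHomTwistIso φ (unitModule X) 1⟩

/-! ## §2 The morphism defined by the coefficients satisfies the criterion -/

section ToProj

variable (hcov : ⨆ i, ⨆ x, X.basicOpen ((CocycleSections.ofFrameSystem F h1 s).coeff i x) = ⊤)
  (q : X ⟶ Spec (.of A))

/-- **`φ⁻¹D₊(x_i) = X_{s_i}`** for the morphism `φ = D.toProj q` defined by a generating-sections datum `D` on `Fin (r + 1)`, in the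
ProjCech spelling `Zop φ {i}` of the chart (★ `Zop_singleton_eq_preU`, ★ `toProj_preimage_basicOpen`).
[cite: Hartshorne1977, II Thm. 7.1 (b) (p. 150)] -/
theorem Zop_toProj_singleton_eq_U (D : GeneratingSections (Fin (r + 1)) X) (q : X ⟶ Spec (.of A)) (i : Fin (r + 1)) :
    Zop (D.toProj q) {i} = D.U i := by
  rw [Zop_singleton_eq_preU]
  exact D.toProj_preimage_basicOpen q i

/-- For the datum of the coefficients of the `s_i`: `φ⁻¹D₊(x_i) ∩ U_x` is the non-vanishing locus of the coefficient `(s_i)_x`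
(★ `iSup_basicOpen_coeffAt_inf`: `X_{s_i}` is computed in any local generator). [cite: Hartshorne1977, II proof of Thm. 7.1 (p. 150)] -/
theorem Zop_toProj_inf_eq_basicOpen_coeffAt (i : Fin (r + 1)) (x : X) :
    Zop ((ofCocycleSections F.U (CocycleSections.ofFrameSystem F h1 s) hcov).toProj q) {i} ⊓ F.U x =
      X.basicOpen (coeffAt F h1 s i x) := by
  rw [Zop_toProj_singleton_eq_U]
  exact iSup_basicOpen_coeffAt_inf F h1 s i x

/-- The coefficient `(s_a)_x` is a unit on every open `V ⊆ U_x ∩ φ⁻¹D₊(x_a)` (there `s_a` generates).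
[cite: Hartshorne1977, II proof of Thm. 7.1 (p. 150)] -/
theorem isUnit_secRes_coeffAt (a : Fin (r + 1)) (x : X) {V : X.Opens} (hx : V ≤ F.U x)
    (ha : V ≤ Zop ((ofCocycleSections F.U (CocycleSections.ofFrameSystem F h1 s) hcov).toProj q) {a}) :
    IsUnit (secRes X hx (coeffAt F h1 s a x)) := by
  have hB : V ≤ X.basicOpen (coeffAt F h1 s a x) := by
    rw [← Zop_toProj_inf_eq_basicOpen_coeffAt F h1 s hcov q]; exact le_inf ha hx
  exact isUnit_map_of_le_basicOpen _ hB

/-- **`φ^*(x_i/x_a) = s_i/s_a`**: on `V ⊆ U_y ∩ φ⁻¹D₊(x_a)` the chart function `x_i/x_a` of `φ = D.toProj q` (★ `SerreTwist.chartFun`,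
= `φ^*(x_i/x_a)` by (L1) `chartFun_eq_map_homRatio`, = the glued ratio `s_i/s_a` by ★ `homRatio_toProj`) times the coefficient
`(s_a)_y` is the coefficient `(s_i)_y` (the defining local formula ★ `ofCocycleSections_ratio_res_mul`).
[cite: Hartshorne1977, II Thm. 7.1 (b) (p. 150)] -/
theorem secRes_chartFun_toProj_mul_coeffAt (i a : Fin (r + 1)) (y : X) {V : X.Opens} (hy : V ≤ F.U y)
    (ha : V ≤ Zop ((ofCocycleSections F.U (CocycleSections.ofFrameSystem F h1 s) hcov).toProj q) {a}) :
    secRes X ha (chartFun ((ofCocycleSections F.U (CocycleSections.ofFrameSystem F h1 s) hcov).toProj q) i a) *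
        secRes X hy (coeffAt F h1 s a y) =
      secRes X hy (coeffAt F h1 s i y) := by
  have haU : V ≤ (ofCocycleSections F.U (CocycleSections.ofFrameSystem F h1 s) hcov).U a := by
    rw [← Zop_toProj_singleton_eq_U _ q]; exact ha
  have hB : V ≤ X.basicOpen ((CocycleSections.ofFrameSystem F h1 s).coeff a y) := by
    show V ≤ X.basicOpen (coeffAt F h1 s a y)
    rw [← Zop_toProj_inf_eq_basicOpen_coeffAt F h1 s hcov q]; exact le_inf ha hy
  -- the defining formula `(s_i/s_a) · (s_a)_y = (s_i)_y` on `X_{(s_a)_y}`, restricted to `V`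
  have key := congrArg (secRes X hB)
    (ofCocycleSections_ratio_res_mul F.U (CocycleSections.ofFrameSystem F h1 s) hcov a i y)
  simp only [map_mul] at key
  have k1 : secRes X hB (X.presheaf.map (homOfLE (basicOpen_le_ofCocycleSections_U F.U
      (CocycleSections.ofFrameSystem F h1 s) hcov a y)).op
      ((ofCocycleSections F.U (CocycleSections.ofFrameSystem F h1 s) hcov).ratio a i)) =
      secRes X haU ((ofCocycleSections F.U (CocycleSections.ofFrameSystem F h1 s) hcov).ratio a i) :=
    secRes_secRes _ _ _
  have k2 : ∀ l, secRes X hB (X.presheaf.map (homOfLE (X.basicOpen_le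
      ((CocycleSections.ofFrameSystem F h1 s).coeff a y))).op ((CocycleSections.ofFrameSystem F h1 s).coeff l y)) =
      secRes X hy (coeffAt F h1 s l y) := fun l => secRes_secRes _ _ _
  rw [k1, k2, k2] at key
  -- the chart function is the same restricted ratio
  have k3 : secRes X ha (chartFun ((ofCocycleSections F.U (CocycleSections.ofFrameSystem F h1 s) hcov).toProj q) i a) =
      secRes X haU ((ofCocycleSections F.U (CocycleSections.ofFrameSystem F h1 s) hcov).ratio a i) := by
    rw [chartFun_eq_map_homRatio, homRatio_toProj]
    exact (secRes_secRes _ _ _).trans (secRes_secRes _ _ _)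
  rw [k3, key]

/-! ## §3 `E ≅ 𝒪_X(1)` for the morphism defined by `(E, s)` -/

/-- **HEAD (V1), Proj form.  The rank-one module whose frame sections define `φ = ι_E : X → 𝐏ʳ_A` IS `φ^*𝒪(1)`**: for a rank-one frame
system `F` of `E`, global sections `s₀, …, s_r` whose non-vanishing loci cover, and `φ := (ofCocycleSections F.U (ofFrameSystem F h1 s)
hcov).toProj q` the morphism they define ([Hartshorne1977] II Thm. 7.1 (b)), `E ≅ 𝒪_X(1) = SerreTwist.twistMod φ 𝒪_X 1`
([Hartshorne1977] II Thm. 7.1 (a), the converse of (L1) ★ `toProj_ofFrameSystem_monomialSection_one`; §1 criterion at the §2 facts).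
[cite: Hartshorne1977, II Thm. 7.1 (a) (p. 150)] [cite: MumfordFogartyKirwan1994, Ch. 7 §2 Def. 7.5 (p. 130)] -/
theorem nonempty_iso_twistMod_one_toProj_ofFrameSystem :
    Nonempty (E ≅ twistMod ((ofCocycleSections F.U (CocycleSections.ofFrameSystem F h1 s) hcov).toProj q) (unitModule X) 1) :=
  nonempty_iso_twistMod_one_of_coeffAt F h1 s _ (Zop_toProj_inf_eq_basicOpen_coeffAt F h1 s hcov q)
    ((iSup_basicOpen_coeffAt_eq_top_iff F h1 s).mp hcov)
    (fun i a y _ hy ha => secRes_chartFun_toProj_mul_coeffAt F h1 s hcov q i a y hy ha)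

end ToProj

/-- **HEAD (V2), the `𝐏(J; S)` form** (the shape ★ `PolarizedAbelianSchemeWithLevel.IsFrameRigidification` ends in: the `S`-point
★ `Morphisms.projectiveSpace.pointOfSections (Over.mk q) D` of `𝐏(J; S)` read back as a morphism `X → 𝐏ⁿ_ℤ` by ★ `homEquiv`): the
rank-one module whose frame sections define that point IS the Serre twist `𝒪_X(1)` along it (★ `homEquiv_pointOfSections` + (V1) over
`ℤ`).  [cite: Hartshorne1977, II Thm. 7.1 (a) (p. 150)] [cite: MumfordFogartyKirwan1994, Ch. 7 §2 Def. 7.5 (p. 130)] -/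
theorem nonempty_iso_twistMod_one_homEquiv_pointOfSections_ofFrameSystem {J : Type u} [Finite J] {X S : Scheme.{u}}
    (q : X ⟶ S) {E : X.Modules} (F : FrameSystem E) (h1 : ∀ x, F.rank x = 1) (s : Fin (Nat.card J + 1) → Γ(E, ⊤))
    (hcov : ⨆ i, ⨆ x, X.basicOpen ((CocycleSections.ofFrameSystem F h1 s).coeff i x) = ⊤) :
    Nonempty (E ≅ twistMod (Morphisms.projectiveSpace.homEquiv (ι := J) (Over.mk q)
      (Morphisms.projectiveSpace.pointOfSections (Over.mk q)
        (ofCocycleSections F.U (CocycleSections.ofFrameSystem F h1 s) hcov))) (unitModule X) 1) := by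
  rw [Morphisms.projectiveSpace.homEquiv_pointOfSections]
  exact nonempty_iso_twistMod_one_toProj_ofFrameSystem F h1 s hcov _

end SerreTwist

end Literature.AlgebraicGeometry.Modules

end
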